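import Literature.NumberTheory.ModularSymbols.FullLevelHomologyCarrier
import Literature.NumberTheory.EllipticCurves.HidaOrdinaryCohomologyCocycles
import Literature.Algebra.Homology.GroupHomologyDegreeOneEndo
import HarnessLib

/-!
# The Hecke operator `T_q` (`q ∤ pM`) on the full-level carrier `H₁(Γ₀(M), k[GL₂(ℤ/p)])`: the chain-level operator
# `[γ] ⊗ f ↦ Σᵢ [γ'ᵢ] ⊗ β̄ᵢ f`, its compatibility with `d₁`, `d₂`, and the induced endomorphism of `H₁`

Topic `Literature/NumberTheory/ModularSymbols`; namespace `Literature.NumberTheory.ModularSymbols.FullLevel`; sequel of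
`FullLevelHomologyCarrier`.  Uses the tree's Hecke coset data for `Γ₀(M)` (`EichlerShimuraPeriods`: `heckeRep q i = βᵢ`,
`heckePerm hq γ = σ_γ`, `heckePermElt hq γ i = γ'ᵢ` with `γ'ᵢ β_{σ_γ i} = βᵢ γ`; `heckePermEquiv`; cocycle identities
`HidaCohomology.heckePerm_mul`, `heckePermElt_mul`, `gmat_heckePermElt_mul` of `HidaOrdinaryCohomologyCocycles`) and the generic
`Algebra/Homology/GroupHomologyDegreeOneEndo` (`H1Endo.lift`).  Definitions with bodies + proved theorems; no named fact,
no `sorry`, no instance, no notation.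

* `redMat p m h ∈ GL₂(ℤ/p)` (reduction of an integer matrix with `det` a unit mod `p`; `redMat_mul`, `redMat_gmat = redGL`),
  **`betaBar p M hq hqp i = β̄ᵢ`** (`q ≠ p` primes), and the REDUCED COSET IDENTITY
  `redGL(γ'ᵢ) β̄_{σi} = β̄ᵢ redGL(γ)` (`redGL_heckePermElt_mul_betaBar`), `redGL(γ'ᵢ)⁻¹ β̄ᵢ = β̄_{σ i} redGL(γ)⁻¹`.
* `coeffAct k p M g` (left translation `δ_x ↦ δ_{gx}` on `k[GL₂(ℤ/p)]`; `(coeff).ρ γ = coeffAct (redGL γ)`),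
  `heckeCoeff = T₀ = Σᵢ β̄ᵢ⋆` and **`heckeChain k p M hq hqp : C₁ → C₁`, `[γ] ⊗ f ↦ Σᵢ [γ'ᵢ] ⊗ β̄ᵢ f`** — the homological
  form of Shimura's (8.3.2) (coefficients twisted by the representative of the SOURCE coset); `heckeChain₂` on `2`-chains.
* **`d₁₀_heckeChain`**: `d₁(T_q c) = T₀(d₁ c)` (from `γ'ᵢ⁻¹β̄ᵢ = β̄_{σi}γ⁻¹` and the bijectivity of `σ_γ`);
  **`heckeChain_d₂₁`**: `T_q ∘ d₂ = d₂ ∘ T_q⁽²⁾` (from `σ_{gh} = σ_h σ_g`, `(gh)'ᵢ = g'ᵢ h'_{σ_g i}`); hence `T_q` preserves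
  `Z₁` and `B₁` (`heckeChain_mem_cycles₁`, `heckeChain_mem_boundaries₁`) and induces
  **`heckeT k p M hq hqp : H₁(Γ₀(M), k[GL₂(ℤ/p)]) →ₗ[k] H₁(Γ₀(M), k[GL₂(ℤ/p)])`**, `heckeT_H1π` (`T_q[c] = [T_q c]`).
  Equivariance under `GL₂(ℤ/p)` and the restriction to torus invariants are in `FullLevelHomologyHeckeEquivariant`.

This is step (H) of the K-line carrier plan (memo CARRIER-gen1 §3/§6, route BSD/TeichmullerTwistDescent, crux
`TwistedPeriodLatticeSaturation`): with `T_q` the eigen-ideals `𝔪`, `𝔭_W` of the audit (S2)–(S5) become definable on the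
carrier.  The comparison with the tree's `T_q` on `H(p²M; k)` (`CuspidalHomologyHeckeModule.heckeOp`) under the up/down
dictionary is NOT here.  Nothing about any elliptic curve is asserted.

## References
* G. Shimura, *Introduction to the arithmetic theory of automorphic functions* (1971), §8.3 (8.3.2), p. 237. [Shimura1971]
* A. Ash, G. Stevens, Duke Math. J. 53 (1986), §1 (1.2)–(1.4) (Hecke operators on `H_*(Γ, M)` commute with the
  coefficient-group action). [AshStevens1986]
-/

noncomputable section

namespace Literature.NumberTheory.ModularSymbols

namespace FullLevel

open scoped MatrixGroups
open CategoryTheory CongruenceSubgroup groupHomology Finsupp Matrix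
open Literature.Algebra.Homology
open Literature.NumberTheory.EllipticCurves.ModularForms

variable (k : Type) [CommRing k] (p M : ℕ) [Fact p.Prime]

/-! ### Reduction of integer matrices of determinant prime to `p`; the elements `β̄ᵢ ∈ GL₂(ℤ/p)` -/

/-- Reduction mod `p` of an integer matrix whose determinant is a unit mod `p`, as an element of `GL₂(ℤ/p)`.
[cite: Shimura1971, §8.3] -/
def redMat (m : Matrix (Fin 2) (Fin 2) ℤ) (h : ((m.det : ℤ) : ZMod p) ≠ 0) : GL (Fin 2) (ZMod p) :=
  Matrix.GeneralLinearGroup.mkOfDetNeZero (m.map (Int.castRingHom (ZMod p))) (by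
    rw [← RingHom.mapMatrix_apply, ← RingHom.map_det, eq_intCast]; exact h)

/-- Entries of `redMat`. [cite: Shimura1971, §8.3] -/
theorem redMat_apply (m : Matrix (Fin 2) (Fin 2) ℤ) (h : ((m.det : ℤ) : ZMod p) ≠ 0) (i j : Fin 2) :
    ((redMat p m h : GL (Fin 2) (ZMod p)) : Matrix (Fin 2) (Fin 2) (ZMod p)) i j = ((m i j : ℤ) : ZMod p) := by
  simp [redMat, Matrix.GeneralLinearGroup.mkOfDetNeZero]

/-- The reduction of `γ ∈ Γ₀(M)` qua integer matrix is `redGL γ`. [cite: Shimura1971, §8.3] -/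
theorem redMat_gmat (γ : Gamma0 M) (h : ((((γ : SL(2, ℤ)) : Matrix (Fin 2) (Fin 2) ℤ).det : ℤ) : ZMod p) ≠ 0) :
    redMat p ((γ : SL(2, ℤ)) : Matrix (Fin 2) (Fin 2) ℤ) h = redGL p M γ := by
  apply Matrix.GeneralLinearGroup.ext
  intro i j
  rw [redMat_apply, redGL_apply_coe]

/-- `redMat` is multiplicative. [cite: Shimura1971, §8.3] -/
theorem redMat_mul (m n : Matrix (Fin 2) (Fin 2) ℤ) (hm : ((m.det : ℤ) : ZMod p) ≠ 0)
    (hn : ((n.det : ℤ) : ZMod p) ≠ 0) (hmn : (((m * n).det : ℤ) : ZMod p) ≠ 0) :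
    redMat p (m * n) hmn = redMat p m hm * redMat p n hn := by
  apply Matrix.GeneralLinearGroup.ext
  intro i j
  rw [Units.val_mul, redMat_apply, Matrix.mul_apply, Matrix.mul_apply, Fin.sum_univ_two, Fin.sum_univ_two,
    redMat_apply, redMat_apply, redMat_apply, redMat_apply]
  push_cast
  ring

variable {q : ℕ} (hq : q.Prime) (hqp : q ≠ p)

include hq hqp in
/-- `det βᵢ = q` is a unit mod `p` (`q ≠ p` primes). [cite: Shimura1971, §8.3] -/
theorem det_heckeRep_cast_ne_zero (i : Option (ZMod q)) : (((heckeRep q i).det : ℤ) : ZMod p) ≠ 0 := by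
  rw [det_heckeRep, Int.cast_natCast, Ne, ZMod.natCast_eq_zero_iff]
  intro h
  exact hqp (((Nat.prime_dvd_prime_iff_eq (Fact.out : p.Prime) hq).1 h).symm)

/-- The Hecke representative `β̄ᵢ ∈ GL₂(ℤ/p)` (reduction of `βᵢ = (1 j; 0 q)` / `diag(q, 1)`).
[cite: Shimura1971, §8.3 p. 237] -/
def betaBar (i : HeckeIdx M q) : GL (Fin 2) (ZMod p) :=
  redMat p (heckeRep q i.1) (det_heckeRep_cast_ne_zero p hq hqp i.1)

/-- **The coset identity reduced mod `p`**: `redGL(γ'ᵢ) · β̄_{σ(i)} = β̄ᵢ · redGL(γ)`. [cite: Shimura1971, §8.3 p. 237] -/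
theorem redGL_heckePermElt_mul_betaBar (γ : Gamma0 M) (i : HeckeIdx M q) :
    redGL p M (heckePermElt hq γ i) * betaBar p M hq hqp (heckePerm hq γ i) =
      betaBar p M hq hqp i * redGL p M γ := by
  have hγ : ∀ δ : Gamma0 M, ((((δ : SL(2, ℤ)) : Matrix (Fin 2) (Fin 2) ℤ).det : ℤ) : ZMod p) ≠ 0 := fun δ => by
    rw [Matrix.SpecialLinearGroup.det_coe, Int.cast_one]; exact one_ne_zero
  have h := HidaCohomology.gmat_heckePermElt_mul hq γ i
  have hl : ((( ((heckePermElt hq γ i : Gamma0 M) : SL(2, ℤ)) : Matrix (Fin 2) (Fin 2) ℤ) *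
      heckeRep q (heckePerm hq γ i).1).det : ZMod p) ≠ 0 := by
    rw [Matrix.det_mul, Int.cast_mul]; exact mul_ne_zero (hγ _) (det_heckeRep_cast_ne_zero p hq hqp _)
  have hr : (((heckeRep q i.1 * ((γ : SL(2, ℤ)) : Matrix (Fin 2) (Fin 2) ℤ)).det : ℤ) : ZMod p) ≠ 0 := by
    rw [Matrix.det_mul, Int.cast_mul]; exact mul_ne_zero (det_heckeRep_cast_ne_zero p hq hqp _) (hγ _)
  rw [← redMat_gmat p M (heckePermElt hq γ i) (hγ _), ← redMat_gmat p M γ (hγ γ), betaBar, betaBar,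
    ← redMat_mul p _ _ (hγ _) _ hl, ← redMat_mul p _ _ _ (hγ γ) hr]
  simp only [HidaCohomology.gmat] at h
  simp only [h]

/-- The rearranged form `redGL(γ'ᵢ)⁻¹ · β̄ᵢ = β̄_{σ(i)} · redGL(γ)⁻¹`. [cite: Shimura1971, §8.3 p. 237] -/
theorem redGL_heckePermElt_inv_mul_betaBar (γ : Gamma0 M) (i : HeckeIdx M q) :
    (redGL p M (heckePermElt hq γ i))⁻¹ * betaBar p M hq hqp i =
      betaBar p M hq hqp (heckePerm hq γ i) * (redGL p M γ)⁻¹ := by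
  rw [inv_mul_eq_iff_eq_mul, ← mul_assoc, redGL_heckePermElt_mul_betaBar, mul_assoc, mul_inv_cancel, mul_one]

end FullLevel

end Literature.NumberTheory.ModularSymbols

namespace Literature.NumberTheory.ModularSymbols

namespace FullLevel

open scoped MatrixGroups
open CategoryTheory CongruenceSubgroup groupHomology Finsupp Matrix
open Literature.Algebra.Homology
open Literature.NumberTheory.EllipticCurves.ModularForms

variable (k : Type) [CommRing k] (p M : ℕ)

/-! ### The Hecke operator `T_q` on `1`-chains of `Γ₀(M)` with coefficients in `k[GL₂(ℤ/p)]` -/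

/-- Left translation `δ_x ↦ δ_{gx}` on the coefficients `k[GL₂(ℤ/p)]` (the action of integer matrices of determinant
prime to `p` through their reduction; for `γ ∈ Γ₀(M)` it is `(coeff k p M).ρ γ`). [cite: AshStevens1986, §1 (1.2)] -/
def coeffAct (g : GL (Fin 2) (ZMod p)) : coeff k p M →ₗ[k] coeff k p M :=
  Finsupp.lmapDomain k k (g * ·)

/-- `coeffAct g (aδ_x) = aδ_{gx}`. [cite: AshStevens1986, §1 (1.2)] -/
theorem coeffAct_single (g x : GL (Fin 2) (ZMod p)) (a : k) :
    coeffAct k p M g (single x a) = single (g * x) a := by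
  simp [coeffAct, mapDomain_single]

/-- `coeffAct (gh) = coeffAct g ∘ coeffAct h`. [cite: AshStevens1986, §1 (1.2)] -/
theorem coeffAct_mul (g h : GL (Fin 2) (ZMod p)) :
    coeffAct k p M (g * h) = coeffAct k p M g ∘ₗ coeffAct k p M h := by
  rw [coeffAct, coeffAct, coeffAct, ← Finsupp.lmapDomain_comp]
  congr 1
  funext x
  simp [mul_assoc]

/-- The representation of `Γ₀(M)` on the coefficients is `coeffAct ∘ redGL`. [cite: AshStevens1986, §1 (1.2)] -/
theorem coeff_ρ_eq_coeffAct (γ : Gamma0 M) : (coeff k p M).ρ γ = coeffAct k p M (redGL p M γ) := rfl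

variable [Fact p.Prime] {q : ℕ} [NeZero q] (hq : q.Prime) (hqp : q ≠ p)

/-- The degree-`0` operator `T₀ = Σᵢ β̄ᵢ ⋆` on coefficients. [cite: Shimura1971, §8.3 (8.3.2)] -/
def heckeCoeff : coeff k p M →ₗ[k] coeff k p M := ∑ i : HeckeIdx M q, coeffAct k p M (betaBar p M hq hqp i)

/-- Unfolding `heckeCoeff`. [cite: Shimura1971, §8.3 (8.3.2)] -/
theorem heckeCoeff_apply (f : coeff k p M) :
    heckeCoeff k p M hq hqp f = ∑ i : HeckeIdx M q, coeffAct k p M (betaBar p M hq hqp i) f := by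
  simp [heckeCoeff, LinearMap.sum_apply]

/-- **The Hecke operator `T_q` on `1`-chains**: `[γ] ⊗ f ↦ Σᵢ [γ'ᵢ] ⊗ β̄ᵢf` where `βᵢ γ = γ'ᵢ β_{σ_γ(i)}`
(the homological counterpart of Shimura's (8.3.2); the coefficient is twisted by the representative of the SOURCE
coset). [cite: Shimura1971, §8.3 (8.3.2)] -/
def heckeChain : (Gamma0 M →₀ coeff k p M) →ₗ[k] (Gamma0 M →₀ coeff k p M) :=
  Finsupp.lsum k fun γ => ∑ i : HeckeIdx M q,
    (Finsupp.lsingle (heckePermElt hq γ i)).comp (coeffAct k p M (betaBar p M hq hqp i))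

/-- `T_q([γ] ⊗ f) = Σᵢ [γ'ᵢ] ⊗ β̄ᵢ f`. [cite: Shimura1971, §8.3 (8.3.2)] -/
theorem heckeChain_single (γ : Gamma0 M) (f : coeff k p M) :
    heckeChain k p M hq hqp (single γ f) =
      ∑ i : HeckeIdx M q, single (heckePermElt hq γ i) (coeffAct k p M (betaBar p M hq hqp i) f) := by
  simp [heckeChain]

omit [NeZero q] in
/-- The action of `γ'ᵢ⁻¹` on `β̄ᵢ f` is `β̄_{σ(i)} γ⁻¹ f`. [cite: Shimura1971, §8.3 p. 237] -/
theorem ρ_heckePermElt_inv_coeffAct (γ : Gamma0 M) (i : HeckeIdx M q) (f : coeff k p M) :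
    (coeff k p M).ρ (heckePermElt hq γ i)⁻¹ (coeffAct k p M (betaBar p M hq hqp i) f) =
      coeffAct k p M (betaBar p M hq hqp (heckePerm hq γ i)) ((coeff k p M).ρ γ⁻¹ f) := by
  rw [coeff_ρ_eq_coeffAct, coeff_ρ_eq_coeffAct, ← LinearMap.comp_apply, ← coeffAct_mul, map_inv,
    redGL_heckePermElt_inv_mul_betaBar, ← LinearMap.comp_apply, ← coeffAct_mul, map_inv]

/-- **`T_q` is a chain map over `T₀`**: `d(T_q c) = T₀(d c)`. [cite: Shimura1971, §8.3] -/
theorem d₁₀_heckeChain (c : Gamma0 M →₀ coeff k p M) :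
    (d₁₀ (coeff k p M)).hom (heckeChain k p M hq hqp c) = heckeCoeff k p M hq hqp ((d₁₀ (coeff k p M)).hom c) := by
  induction c using Finsupp.induction_linear with
  | zero => simp
  | add c₁ c₂ h₁ h₂ => rw [map_add, map_add, h₁, h₂, map_add, map_add]
  | single γ f =>
    have hd : ∀ g (a : coeff k p M), (d₁₀ (coeff k p M)).hom (single g a) = (coeff k p M).ρ g⁻¹ a - a :=
      fun g a => d₁₀_single (A := coeff k p M) g a
    have e : ∀ i : HeckeIdx M q,
        (d₁₀ (coeff k p M)).hom (single (heckePermElt hq γ i) (coeffAct k p M (betaBar p M hq hqp i) f)) =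
          coeffAct k p M (betaBar p M hq hqp (heckePerm hq γ i)) ((coeff k p M).ρ γ⁻¹ f) -
            coeffAct k p M (betaBar p M hq hqp i) f := fun i => by
      rw [hd, ρ_heckePermElt_inv_coeffAct]
    rw [heckeChain_single, map_sum, Finset.sum_congr rfl (fun i _ => e i), Finset.sum_sub_distrib, hd,
      map_sub (heckeCoeff k p M hq hqp), heckeCoeff_apply, heckeCoeff_apply]
    congr 1
    exact Fintype.sum_equiv (heckePermEquiv hq γ) _ _ (fun i => rfl)

/-- `T_q` preserves `1`-cycles. [cite: Shimura1971, §8.3] -/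
theorem heckeChain_mem_cycles₁ (c : Gamma0 M →₀ coeff k p M) (hc : c ∈ cycles₁ (coeff k p M)) :
    heckeChain k p M hq hqp c ∈ cycles₁ (coeff k p M) := by
  change (d₁₀ (coeff k p M)).hom _ = 0
  rw [d₁₀_heckeChain, show (d₁₀ (coeff k p M)).hom c = 0 from hc, map_zero]

/-- `T_q` on `2`-chains: `(g, h) ⊗ a ↦ Σᵢ (g'ᵢ, h'_{σ_g(i)}) ⊗ β̄ᵢ a`. [cite: Shimura1971, §8.3] -/
def heckeChain₂ : (Gamma0 M × Gamma0 M →₀ coeff k p M) →ₗ[k] (Gamma0 M × Gamma0 M →₀ coeff k p M) :=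
  Finsupp.lsum k fun gh => ∑ i : HeckeIdx M q,
    (Finsupp.lsingle (heckePermElt hq gh.1 i, heckePermElt hq gh.2 (heckePerm hq gh.1 i))).comp
      (coeffAct k p M (betaBar p M hq hqp i))

/-- Unfolding `heckeChain₂` on a single. [cite: Shimura1971, §8.3] -/
theorem heckeChain₂_single (g h : Gamma0 M) (a : coeff k p M) :
    heckeChain₂ k p M hq hqp (single (g, h) a) = ∑ i : HeckeIdx M q,
      single (heckePermElt hq g i, heckePermElt hq h (heckePerm hq g i)) (coeffAct k p M (betaBar p M hq hqp i) a) := by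
  simp [heckeChain₂]

/-- **`T_q ∘ d₂ = d₂ ∘ T_q⁽²⁾`** (the cocycle identities `σ_{gh} = σ_h σ_g`, `(gh)'ᵢ = g'ᵢ h'_{σ_g i}`).
[cite: Shimura1971, §8.3 p. 237] -/
theorem heckeChain_d₂₁ (w : Gamma0 M × Gamma0 M →₀ coeff k p M) :
    heckeChain k p M hq hqp ((d₂₁ (coeff k p M)).hom w) = (d₂₁ (coeff k p M)).hom (heckeChain₂ k p M hq hqp w) := by
  induction w using Finsupp.induction_linear with
  | zero => simp
  | add w₁ w₂ h₁ h₂ => rw [map_add, map_add, h₁, h₂, map_add, map_add]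
  | single gh a =>
    obtain ⟨g, h⟩ := gh
    have hd : ∀ (x : Gamma0 M × Gamma0 M) (b : coeff k p M), (d₂₁ (coeff k p M)).hom (single x b) =
        single x.2 ((coeff k p M).ρ x.1⁻¹ b) - single (x.1 * x.2) b + single x.1 b :=
      fun x b => d₂₁_single (A := coeff k p M) x b
    have e : ∀ i : HeckeIdx M q,
        (d₂₁ (coeff k p M)).hom (single (heckePermElt hq g i, heckePermElt hq h (heckePerm hq g i))
          (coeffAct k p M (betaBar p M hq hqp i) a)) =
        single (heckePermElt hq h (heckePerm hq g i))
            (coeffAct k p M (betaBar p M hq hqp (heckePerm hq g i)) ((coeff k p M).ρ g⁻¹ a)) -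
          single (heckePermElt hq (g * h) i) (coeffAct k p M (betaBar p M hq hqp i) a) +
          single (heckePermElt hq g i) (coeffAct k p M (betaBar p M hq hqp i) a) := fun i => by
      rw [hd, ρ_heckePermElt_inv_coeffAct, HidaCohomology.heckePermElt_mul hq g h]
    rw [hd, heckeChain₂_single, map_sum, Finset.sum_congr rfl (fun i _ => e i), Finset.sum_add_distrib,
      Finset.sum_sub_distrib, map_add (heckeChain k p M hq hqp), map_sub (heckeChain k p M hq hqp),
      heckeChain_single, heckeChain_single, heckeChain_single]
    congr 2
    exact (Fintype.sum_equiv (heckePermEquiv hq g)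
      (fun i => single (heckePermElt hq h (heckePerm hq g i))
        (coeffAct k p M (betaBar p M hq hqp (heckePerm hq g i)) ((coeff k p M).ρ g⁻¹ a)))
      (fun j => single (heckePermElt hq h j) (coeffAct k p M (betaBar p M hq hqp j) ((coeff k p M).ρ g⁻¹ a)))
      (fun i => rfl)).symm

/-- `T_q` preserves `1`-boundaries. [cite: Shimura1971, §8.3] -/
theorem heckeChain_mem_boundaries₁ (c : Gamma0 M →₀ coeff k p M) (hc : c ∈ boundaries₁ (coeff k p M)) :
    heckeChain k p M hq hqp c ∈ boundaries₁ (coeff k p M) := by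
  obtain ⟨w, rfl⟩ := hc
  exact ⟨heckeChain₂ k p M hq hqp w, (heckeChain_d₂₁ k p M hq hqp w).symm⟩

/-! ### `T_q` on `H₁(Γ₀(M), k[GL₂(ℤ/p)])` -/

/-- **The Hecke operator `T_q` (`q ∤ pM` prime) on the full-level carrier `H₁(Γ₀(M), k[GL₂(ℤ/p)])`.**
[cite: Shimura1971, §8.3 (8.3.2); AshStevens1986, §1 (1.4)] -/
def heckeT : H1carrier k p M →ₗ[k] H1carrier k p M :=
  H1Endo.lift (heckeChain k p M hq hqp) (heckeChain_mem_cycles₁ k p M hq hqp) (heckeChain_mem_boundaries₁ k p M hq hqp)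

/-- `T_q [c] = [T_q c]` on classes of `1`-cycles. [cite: Shimura1971, §8.3 (8.3.2)] -/
theorem heckeT_H1π (c : cycles₁ (coeff k p M)) :
    heckeT k p M hq hqp (H1π _ c) = H1π _ ⟨heckeChain k p M hq hqp c.1, heckeChain_mem_cycles₁ k p M hq hqp c.1 c.2⟩ :=
  H1Endo.lift_H1π _ _ _ c

end FullLevel

end Literature.NumberTheory.ModularSymbols
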